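/-
Copyright: rh-split cell, seat prover-l1 (L1/L19 «DUST WALL»), 2026-08-27.  ζ-free analysis.
Nothing here bears on the truth of RH.
-/
import Summits.RiemannHypothesis.RiemannHypothesis.Theorems.Splittings.ScrewBorelFluxB
import Literature.Analysis.Complex.ArgumentPrincipleRectangle
import HarnessLib

/-!
# Flux of a Borel series through RECTANGLES: residues of one term, termwise integration on segments

ζ-free kernel pieces for the crux `PointComponentInvisible` (route `ScrewDustWall`, X-11 «DUST WALL»,
stmt-RiemannHypothesis-21690).  §20 (`ScrewBorelFlux`) computed the flux of the Borel series
`B = ∑' i, term (c i) (u i)` through CIRCLES; a point-component of the pole wall is in general met by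
every small circle, so the crux needs GRID CYCLES — boundaries of finite unions of grid squares.  This
file supplies the two analytic inputs, square by square:

* `rectBoundaryIntegral_term` (§1): in the four-term boundary convention of the tree
  (`Literature.Analysis.Complex.rectBoundaryIntegral`: bottom − top + i·right − i·left), for a closed
  rectangle `K ⊆ 𝔻` and a term whose two poles `u`, `u⁻¹` are each either in the open rectangle or
  off the closed one, `∮_{∂K} term c u = -2πi · (charge of the term in K°)`, where the charge on `U` is the
  charge `c/2 · q` summed over the poles `q ∈ {u⁻¹, u}` lying in `U` (the rectangle analogue of
  `ScrewBorelFlux.discWeight`).  Proof: `term c u z = -(c/2)u⁻¹ (z - u⁻¹)⁻¹ - (c/2)u (z - u)⁻¹ +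
  c (z - 1)⁻¹` and the winding integral of the rectangle
  (`Literature.Analysis.Complex.rectBoundaryIntegral_const_mul_inv_sub`) resp. Cauchy–Goursat.
* `hasSum_intervalIntegral_borel` (§2): along any continuous path segment staying `δ`-away from the
  inside pole set and inside `‖z‖ ≤ r'` (`δ ≤ 1 - r'`), `∫ B = ∑' i, ∫ termᵢ` (dominated convergence
  with the uniform bound `ScrewBorel.norm_term_le`, as in `ScrewBorelFlux.hasSum_circleIntegral_borel`).

No `sorry`, no new axioms, no instances, no notation.
-/

set_option linter.dupNamespace false

namespace Summit.RiemannHypothesis.RiemannHypothesis.Theorems.Splittings.ScrewDust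

open Complex Filter Topology Set Metric MeasureTheory
open scoped Real Interval Classical
open Summit.RiemannHypothesis.RiemannHypothesis.Theorems.Splittings.ScrewBorel
open Summit.RiemannHypothesis.RiemannHypothesis.Theorems.Splittings.ScrewBorelFlux
open Literature.Analysis.Complex

/-! ## 1. The residue of one term on a rectangle -/

/-- The CHARGE the term `(c, u)` puts on a set `U ⊆ 𝔻` — `c/2 · q` for each of its poles
`q ∈ {u⁻¹, u}` lying in `U` (cf. `ScrewBorelFlux.discWeight` for discs), written out as
`(if u⁻¹ ∈ U then c/2·u⁻¹ else 0) + (if u ∈ U then c/2·u else 0)` throughout — has norm `≤ ‖c‖`. -/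
theorem norm_setCharge_le {c u : ℂ} {U : Set ℂ} (hU : U ⊆ ball (0 : ℂ) 1) :
    ‖(if u⁻¹ ∈ U then c / 2 * u⁻¹ else 0) + (if u ∈ U then c / 2 * u else 0)‖ ≤ ‖c‖ := by
  have h2 : ‖c / 2‖ = ‖c‖ / 2 := by rw [norm_div]; simp
  have hq : ∀ q : ℂ, q ∈ U → ‖c / 2 * q‖ ≤ ‖c‖ / 2 := by
    intro q hq
    have hq1 : ‖q‖ < 1 := mem_ball_zero_iff.1 (hU hq)
    rw [norm_mul, h2]
    calc ‖c‖ / 2 * ‖q‖ ≤ ‖c‖ / 2 * 1 := by gcongr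
      _ = ‖c‖ / 2 := mul_one _
  have h0 := norm_nonneg c
  refine (norm_add_le _ _).trans ?_
  split_ifs with ha hb hb
  · linarith [hq _ ha, hq _ hb]
  · rw [norm_zero]; linarith [hq _ ha]
  · rw [norm_zero]; linarith [hq _ hb]
  · rw [norm_zero]; linarith

/-- Partial fractions: `term c u z = -(c/2)u⁻¹·(z - u⁻¹)⁻¹ - (c/2)u·(z - u)⁻¹ + c·(z - 1)⁻¹`
(an identity of junk-valued functions, `u ≠ 0`). -/
theorem term_eq_pieces {c u : ℂ} (hu : u ≠ 0) (z : ℂ) :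
    term c u z = (-(c / 2) * u⁻¹) * (z - u⁻¹)⁻¹ + (-(c / 2) * u) * (z - u)⁻¹ + c * (z - 1)⁻¹ := by
  have h1 : (1 - u * z)⁻¹ = -u⁻¹ * (z - u⁻¹)⁻¹ := by
    rw [show 1 - u * z = 1 - z / u⁻¹ by rw [div_inv_eq_mul, mul_comm],
      inv_one_sub_div_eq (inv_ne_zero hu)]
  have h2 : (1 - z / u)⁻¹ = -u * (z - u)⁻¹ := inv_one_sub_div_eq hu z
  have h3 : (1 - z)⁻¹ = -(z - 1)⁻¹ := by rw [← neg_sub z 1, inv_neg]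
  unfold term
  rw [h1, h2, h3]
  ring

/-- Additivity of the boundary integral for integrands continuous at every boundary point of the
rectangle (the four-edge hypothesis of `Literature.Analysis.Complex.rectBoundaryIntegral_add`,
packaged by boundary points). -/
theorem rectBoundaryIntegral_add' {f g : ℂ → ℂ} {x₁ x₂ y₁ y₂ : ℝ} (hx : x₁ ≤ x₂) (hy : y₁ ≤ y₂)
    (hf : ∀ z ∈ Icc x₁ x₂ ×ℂ Icc y₁ y₂, (z.re = x₁ ∨ z.re = x₂ ∨ z.im = y₁ ∨ z.im = y₂) →
      ContinuousAt f z)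
    (hg : ∀ z ∈ Icc x₁ x₂ ×ℂ Icc y₁ y₂, (z.re = x₁ ∨ z.re = x₂ ∨ z.im = y₁ ∨ z.im = y₂) →
      ContinuousAt g z) :
    rectBoundaryIntegral (fun z ↦ f z + g z) x₁ x₂ y₁ y₂ =
      rectBoundaryIntegral f x₁ x₂ y₁ y₂ + rectBoundaryIntegral g x₁ x₂ y₁ y₂ := by
  have hb : ∀ x ∈ Icc x₁ x₂, ((x : ℂ) + y₁ * I) ∈ Icc x₁ x₂ ×ℂ Icc y₁ y₂ ∧
      (((x : ℂ) + y₁ * I).re = x₁ ∨ ((x : ℂ) + y₁ * I).re = x₂ ∨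
        ((x : ℂ) + y₁ * I).im = y₁ ∨ ((x : ℂ) + y₁ * I).im = y₂) := fun x hx ↦
    ⟨by simpa [mem_reProdIm] using ⟨hx, hy⟩, by simp⟩
  have ht : ∀ x ∈ Icc x₁ x₂, ((x : ℂ) + y₂ * I) ∈ Icc x₁ x₂ ×ℂ Icc y₁ y₂ ∧
      (((x : ℂ) + y₂ * I).re = x₁ ∨ ((x : ℂ) + y₂ * I).re = x₂ ∨
        ((x : ℂ) + y₂ * I).im = y₁ ∨ ((x : ℂ) + y₂ * I).im = y₂) := fun x hx ↦
    ⟨by simpa [mem_reProdIm] using ⟨hx, hy⟩, by simp⟩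
  have hl : ∀ y ∈ Icc y₁ y₂, ((x₁ : ℂ) + y * I) ∈ Icc x₁ x₂ ×ℂ Icc y₁ y₂ ∧
      (((x₁ : ℂ) + y * I).re = x₁ ∨ ((x₁ : ℂ) + y * I).re = x₂ ∨
        ((x₁ : ℂ) + y * I).im = y₁ ∨ ((x₁ : ℂ) + y * I).im = y₂) := fun y hy' ↦
    ⟨by simpa [mem_reProdIm] using ⟨hx, hy'⟩, by simp⟩
  have hr : ∀ y ∈ Icc y₁ y₂, ((x₂ : ℂ) + y * I) ∈ Icc x₁ x₂ ×ℂ Icc y₁ y₂ ∧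
      (((x₂ : ℂ) + y * I).re = x₁ ∨ ((x₂ : ℂ) + y * I).re = x₂ ∨
        ((x₂ : ℂ) + y * I).im = y₁ ∨ ((x₂ : ℂ) + y * I).im = y₂) := fun y hy' ↦
    ⟨by simpa [mem_reProdIm] using ⟨hx, hy'⟩, by simp⟩
  exact rectBoundaryIntegral_add hx hy
    (fun x hx' ↦ hf _ (hb x hx').1 (hb x hx').2) (fun x hx' ↦ hf _ (ht x hx').1 (ht x hx').2)
    (fun y hy' ↦ hf _ (hl y hy').1 (hl y hy').2) (fun y hy' ↦ hf _ (hr y hy').1 (hr y hy').2)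
    (fun x hx' ↦ hg _ (hb x hx').1 (hb x hx').2) (fun x hx' ↦ hg _ (ht x hx').1 (ht x hx').2)
    (fun y hy' ↦ hg _ (hl y hy').1 (hl y hy').2) (fun y hy' ↦ hg _ (hr y hy').1 (hr y hy').2)

/-- A pole is ADMISSIBLE for the rectangle `[x₁,x₂] × [y₁,y₂]` if it lies in the open rectangle or off
the closed one; then no boundary point of the rectangle is the pole. -/
theorem ne_of_offRect {ρ z : ℂ} {x₁ x₂ y₁ y₂ : ℝ}
    (hρ : ρ ∈ Ioo x₁ x₂ ×ℂ Ioo y₁ y₂ ∨ ρ ∉ Icc x₁ x₂ ×ℂ Icc y₁ y₂)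
    (hz : z ∈ Icc x₁ x₂ ×ℂ Icc y₁ y₂) (hbd : z.re = x₁ ∨ z.re = x₂ ∨ z.im = y₁ ∨ z.im = y₂) :
    z ≠ ρ := by
  rintro rfl
  rcases hρ with hin | hout
  · rw [mem_reProdIm, mem_Ioo, mem_Ioo] at hin
    rcases hbd with h | h | h | h <;> linarith [hin.1.1, hin.1.2, hin.2.1, hin.2.2]
  · exact hout hz

/-- The polar piece `m·(z - ρ)⁻¹` of an admissible pole is continuous at the boundary points. -/
theorem continuousAt_mul_inv_sub_of_offRect (m : ℂ) {ρ : ℂ} {x₁ x₂ y₁ y₂ : ℝ}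
    (hρ : ρ ∈ Ioo x₁ x₂ ×ℂ Ioo y₁ y₂ ∨ ρ ∉ Icc x₁ x₂ ×ℂ Icc y₁ y₂) :
    ∀ z ∈ Icc x₁ x₂ ×ℂ Icc y₁ y₂, (z.re = x₁ ∨ z.re = x₂ ∨ z.im = y₁ ∨ z.im = y₂) →
      ContinuousAt (fun w : ℂ ↦ m * (w - ρ)⁻¹) z := fun _ hz hbd ↦
  continuousAt_const.mul
    (((continuous_id.sub continuous_const).continuousAt).inv₀
      (sub_ne_zero.2 (ne_of_offRect hρ hz hbd)))

/-- **Polar piece on a rectangle.**  For an admissible pole `ρ`: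
`∮_{∂K} m·(z - ρ)⁻¹ dz = 2πi·m` if `ρ` is in the open rectangle, `= 0` otherwise. -/
theorem rectBoundaryIntegral_mul_inv_sub (m : ℂ) {ρ : ℂ} {x₁ x₂ y₁ y₂ : ℝ} (hx : x₁ ≤ x₂)
    (hy : y₁ ≤ y₂) (hρ : ρ ∈ Ioo x₁ x₂ ×ℂ Ioo y₁ y₂ ∨ ρ ∉ Icc x₁ x₂ ×ℂ Icc y₁ y₂) :
    rectBoundaryIntegral (fun z ↦ m * (z - ρ)⁻¹) x₁ x₂ y₁ y₂ =
      if ρ ∈ Ioo x₁ x₂ ×ℂ Ioo y₁ y₂ then 2 * π * I * m else 0 := by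
  split_ifs with hin
  · have h := hin
    rw [mem_reProdIm] at h
    exact rectBoundaryIntegral_const_mul_inv_sub m ρ h.1.1 h.1.2 h.2.1 h.2.2
  · have hout : ρ ∉ Icc x₁ x₂ ×ℂ Icc y₁ y₂ := hρ.resolve_left hin
    refine rectBoundaryIntegral_eq_zero_of_differentiableOn hx hy fun z hz ↦ ?_
    have hz' : z - ρ ≠ 0 := sub_ne_zero.2 fun h ↦ hout (h ▸ hz)
    exact (((differentiableAt_id.sub_const ρ).inv hz').const_mul m).differentiableWithinAt

/-- **Flux of one term through a rectangle.**  If the closed rectangle `K = [x₁,x₂] × [y₁,y₂]` lies in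
the unit disc and the poles `u`, `u⁻¹` of the term are admissible (in `K°` or off `K`), then
`∮_{∂K} term c u = -2πi ·` (charge of the term in `K°`). -/
theorem rectBoundaryIntegral_term {c u : ℂ} (hu : u ≠ 0) {x₁ x₂ y₁ y₂ : ℝ} (hx : x₁ ≤ x₂)
    (hy : y₁ ≤ y₂) (hsub : Icc x₁ x₂ ×ℂ Icc y₁ y₂ ⊆ ball (0 : ℂ) 1)
    (hu₁ : u ∈ Ioo x₁ x₂ ×ℂ Ioo y₁ y₂ ∨ u ∉ Icc x₁ x₂ ×ℂ Icc y₁ y₂)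
    (hu₂ : u⁻¹ ∈ Ioo x₁ x₂ ×ℂ Ioo y₁ y₂ ∨ u⁻¹ ∉ Icc x₁ x₂ ×ℂ Icc y₁ y₂) :
    rectBoundaryIntegral (term c u) x₁ x₂ y₁ y₂ =
      -(2 * π * I) * ((if u⁻¹ ∈ Ioo x₁ x₂ ×ℂ Ioo y₁ y₂ then c / 2 * u⁻¹ else 0) +
        (if u ∈ Ioo x₁ x₂ ×ℂ Ioo y₁ y₂ then c / 2 * u else 0)) := by
  have h1out : (1 : ℂ) ∉ Icc x₁ x₂ ×ℂ Icc y₁ y₂ := fun h ↦ by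
    have := hsub h
    rw [mem_ball_zero_iff, norm_one] at this
    exact lt_irrefl _ this
  have h1in : (1 : ℂ) ∉ Ioo x₁ x₂ ×ℂ Ioo y₁ y₂ := fun h ↦
    h1out ⟨Ioo_subset_Icc_self h.1, Ioo_subset_Icc_self h.2⟩
  have h1 : (1 : ℂ) ∈ Ioo x₁ x₂ ×ℂ Ioo y₁ y₂ ∨ (1 : ℂ) ∉ Icc x₁ x₂ ×ℂ Icc y₁ y₂ := Or.inr h1out
  have e : term c u = fun z ↦ ((-(c / 2) * u⁻¹) * (z - u⁻¹)⁻¹ + (-(c / 2) * u) * (z - u)⁻¹) +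
      c * (z - 1)⁻¹ := funext fun z ↦ term_eq_pieces hu z
  have hA := continuousAt_mul_inv_sub_of_offRect (-(c / 2) * u⁻¹) hu₂
  have hB := continuousAt_mul_inv_sub_of_offRect (-(c / 2) * u) hu₁
  have hC := continuousAt_mul_inv_sub_of_offRect c h1
  have s1 : rectBoundaryIntegral (fun z ↦ ((-(c / 2) * u⁻¹) * (z - u⁻¹)⁻¹ +
        (-(c / 2) * u) * (z - u)⁻¹) + c * (z - 1)⁻¹) x₁ x₂ y₁ y₂ =
      rectBoundaryIntegral (fun z ↦ (-(c / 2) * u⁻¹) * (z - u⁻¹)⁻¹ + (-(c / 2) * u) * (z - u)⁻¹)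
        x₁ x₂ y₁ y₂ + rectBoundaryIntegral (fun z ↦ c * (z - 1)⁻¹) x₁ x₂ y₁ y₂ := by
    exact rectBoundaryIntegral_add' hx hy (fun z hz hbd ↦ (hA z hz hbd).add (hB z hz hbd)) hC
  have s2 : rectBoundaryIntegral (fun z ↦ (-(c / 2) * u⁻¹) * (z - u⁻¹)⁻¹ +
        (-(c / 2) * u) * (z - u)⁻¹) x₁ x₂ y₁ y₂ =
      rectBoundaryIntegral (fun z ↦ (-(c / 2) * u⁻¹) * (z - u⁻¹)⁻¹) x₁ x₂ y₁ y₂ +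
        rectBoundaryIntegral (fun z ↦ (-(c / 2) * u) * (z - u)⁻¹) x₁ x₂ y₁ y₂ := by
    exact rectBoundaryIntegral_add' hx hy hA hB
  rw [e, s1, s2, rectBoundaryIntegral_mul_inv_sub _ hx hy hu₂,
    rectBoundaryIntegral_mul_inv_sub _ hx hy hu₁, rectBoundaryIntegral_mul_inv_sub _ hx hy h1,
    if_neg h1in]
  split_ifs <;> ring

/-- Cauchy–Goursat for a function holomorphic on the unit disc and a closed rectangle inside it. -/
theorem rectBoundaryIntegral_eq_zero_of_subset_ball {F : ℂ → ℂ} (hF : DifferentiableOn ℂ F (ball 0 1))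
    {x₁ x₂ y₁ y₂ : ℝ} (hx : x₁ ≤ x₂) (hy : y₁ ≤ y₂) (hsub : Icc x₁ x₂ ×ℂ Icc y₁ y₂ ⊆ ball (0 : ℂ) 1) :
    rectBoundaryIntegral F x₁ x₂ y₁ y₂ = 0 :=
  rectBoundaryIntegral_eq_zero_of_differentiableOn hx hy (hF.mono hsub)

/-! ## 2. Termwise integration of the series along a separated path segment -/

/-- **`∫ B = ∑' i, ∫ termᵢ`** along a continuous path `γ` on `[a, b]` whose points have norm `≤ r'`
and stay `δ`-away from the inside pole set, `0 < δ ≤ 1 - r'` (dominated convergence with the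
uniform bound `ScrewBorel.norm_term_le`). -/
theorem hasSum_intervalIntegral_borel {ι : Type*} [Countable ι] {c u : ι → ℂ}
    (hc : Summable fun i ↦ ‖c i‖) (hu : ∀ i, u i ≠ 0) {γ : ℝ → ℂ} (hγ : Continuous γ)
    {a b : ℝ} (hab : a ≤ b) {r' δ : ℝ} (hδ : 0 < δ) (hδr : δ ≤ 1 - r')
    (hzr : ∀ t ∈ Icc a b, ‖γ t‖ ≤ r') (hfar : ∀ t ∈ Icc a b, ∀ q ∈ poleSet u, δ ≤ ‖q - γ t‖) :
    HasSum (fun i ↦ ∫ t in a..b, term (c i) (u i) (γ t))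
      (∫ t in a..b, ∑' i, term (c i) (u i) (γ t)) := by
  have hfar₁ : ∀ t ∈ Icc a b, ∀ i, ‖(u i)⁻¹‖ < 1 → δ ≤ ‖(u i)⁻¹ - γ t‖ :=
    fun t ht i hi ↦ hfar t ht _ ⟨hi, i, Or.inr rfl⟩
  have hfar₂ : ∀ t ∈ Icc a b, ∀ i, ‖u i‖ < 1 → δ ≤ ‖u i - γ t‖ :=
    fun t ht i hi ↦ hfar t ht _ ⟨hi, i, Or.inl rfl⟩
  have hbd : ∀ t ∈ Icc a b, ∀ i, ‖term (c i) (u i) (γ t)‖ ≤ 2 * ‖c i‖ / δ :=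
    fun t ht i ↦ norm_term_le (hu i) hδ hδr (hzr t ht) (hfar₁ t ht i) (hfar₂ t ht i)
  have hda : ∀ t ∈ Icc a b, ∀ i, DifferentiableAt ℂ (fun w ↦ term (c i) (u i) w) (γ t) := by
    intro t ht i
    have e1 := le_norm_one_sub_mul (hu i) hδr (hzr t ht) (hfar₁ t ht i)
    have e2 := le_norm_one_sub_div (hu i) hδr (hzr t ht) (hfar₂ t ht i)
    have e3 := hδr.trans (one_sub_le_norm_one_sub (hzr t ht))
    have n1 : 1 - u i * γ t ≠ 0 := fun h ↦ by rw [h, norm_zero] at e1; linarith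
    have n2 : 1 - γ t / u i ≠ 0 := fun h ↦ by rw [h, norm_zero] at e2; linarith
    have n3 : 1 - γ t ≠ 0 := fun h ↦ by rw [h, norm_zero] at e3; linarith
    exact differentiableAt_term n1 n2 n3
  have hcont : ∀ i, ContinuousOn (fun t ↦ term (c i) (u i) (γ t)) (Icc a b) := fun i t ht ↦
    (((hda t ht i).continuousAt).comp hγ.continuousAt).continuousWithinAt
  have hsb : Summable fun i ↦ 2 * ‖c i‖ / δ := (hc.mul_left 2).div_const δ
  have hI : Ι a b ⊆ Icc a b := by
    rw [uIoc_of_le hab]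
    exact Ioc_subset_Icc_self
  refine intervalIntegral.hasSum_integral_of_dominated_convergence
    (fun i _ ↦ 2 * ‖c i‖ / δ) (fun i ↦ ?_) (fun i ↦ ?_) ?_ ?_ ?_
  · rw [uIoc_of_le hab]
    exact ((hcont i).mono Ioc_subset_Icc_self).aestronglyMeasurable measurableSet_Ioc
  · exact Eventually.of_forall fun t ht ↦ hbd t (hI ht) i
  · exact Eventually.of_forall fun t _ ↦ hsb
  · exact intervalIntegrable_const
  · refine Eventually.of_forall fun t ht ↦ ?_
    exact (Summable.of_norm_bounded hsb (fun i ↦ hbd t (hI ht) i)).hasSum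

end Summit.RiemannHypothesis.RiemannHypothesis.Theorems.Splittings.ScrewDust
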